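import Mathlib
import HarnessLib
import HarnessLib.Audit
import Summits.FinalStateConjecture.Statement
import Literature.Geometry.Lorentzian.KerrTimelikeSpan
import Literature.Geometry.Lorentzian.WeightedNorms
import HarnessLib.Audit.Status.Attr

/-!
Route: StorageCertificates

DORMANT since 2026-08-23T09:42:55Z (reconciler: no traction for 6 d (last activity statement-grounded at 2026-08-17T08:01:29Z); parked, not closed — `ledger route dormant route-FinalStateConjecture-StorageCertificates --off` to reactiva) — unstaffed, not closed; items shared with open routes are served there. `ledger route dormant <id> --off` reactivates.

# Route StorageCertificates — Storage-function certificates close Kerr's bounded superradiant regime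
without mode stability; FSC via subextremal Kerr stability plus the large-data half

It suffices to show X = CertificateFamily ∧ CertificateCompleteness (card
storage-function-duality-superradiant-certificates), read through the
programme items CertificatesToKerrCapture (CertificateFamily → K) and FinalStateFromKerrCapture (K →
the summit statement), where the
waypoint K is the sub-extremal Kerr stability conjecture (Dafermos–Rodnianski Conj. 5.1, gr.S04)
re-stated over the repaired, inhabited
`VacuumCauchyDevelopment` — the structure the summit statement itself uses — and spelled out inline
in both items (rev 2: the rev-1 programme
items went through `SubextremalKerrStabilityConjecture`, which quantifies over the uninhabited
vendored `VacuumDevelopment` and is vacuous;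
K is named `SubextremalKerrCapture` only in the planner's Sketch.lean/Bridge.lean evidence, where
`Iff.rfl` lemmas record that both items
carry it verbatim). CertificateFamily: for every mass M > 0 and spin cap a₀ < M, every bounded box
of DRSR-admissible superradiant frequencies
(ε ≤ ω ≤ mω₊ − ε, |ω| ≤ ω_h, Λ ≤ Λ_h with Λ ≥ |m|(|m|+1), Λ ≥ 2|amω|; a ≥ 0 convention of
arXiv:1402.7034 §4.2) and every core r ∈ [r₊(1+δ), R_c],
there is ONE margin η > 0 such that at every spin 0 ≤ a ≤ a₀ and frequency in the box the Carter
radial operator u ↦ u'' + (ω² − V(R(x)))u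
(V the printed potential of arXiv:1402.7034 §5.2.3 — `Kerr.sepPotential` by `Kerr.sepPotential_eq` —
inlined; R any tortoise radius function,
dR/dx = Δ(R)/(R² + a²), R → r₊ at −∞, R → ∞ at +∞, inlined) admits a normalised C¹ Hermitian storage
form 𝕄 = [[α, β],[β̄, γ]] on (u', u) whose
derivative along solutions H = [[α'+2Re β, β'+γ−αP],[·, γ'−2P Re β]] (P = ω² − V) is ⪰ 0 on ℝ and ⪰
η𝟙 on the core, with end values making the
boundary forms signed on the outgoing line at r → ∞ (γ₊+ω²α₊+2ωb₊ ≤ 0, b = Im β) and on the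
regular-at-𝓗⁺ line (0 ≤ γ₋+k₋²α₋−2k₋b₋, k₋ = ω − mω₊).
CertificateCompleteness (the card's Theorem C, compact model): for a continuous potential on [−L, L]
with Robin ends u'(L) = ik₊u(L),
u'(−L) = −ik₋u(−L) (k₊ > 0, k₋ ≠ 0), absence of a nontrivial solution ("real mode") implies a strict
certificate exists — the converse-Lyapunov
half; soundness is the support item CertificateEstimate.
Lean: `CertificateFamily ∧ CertificateCompleteness`

## Assembly
Pure logic (sorry-free in Sketch.lean and glue.lean): CertificatesToKerrCapture applied to
CertificateFamily gives the waypoint K;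
FinalStateFromKerrCapture turns K into `FinalStateConjecture` (`closes := h₃ (h₂ h₁)`; the two
inline copies of K are syntactically identical).
CertificateCompleteness, CertificateEstimate and CardInstance are not hypotheses of `closes`: they
are the existence principle, the soundness
canary and the first concrete instance behind CertificateFamily (CardInstance is literally its
specialisation, checked by `example` in
Sketch.lean). No rank-0 Target item is filed (X is a conjunction of two items and a target decl
would be a forward reference in the rendered
file, as rev 1 showed).

Rationale: WHY THIS LINE. Every printed treatment of linear and nonlinear waves on subextremal Kerr closes the
bounded-frequency regime ω_low ≤ |ω| ≤ ω_high through one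
non-constructive, exact-Kerr input — the quantitative refinement (arXiv:1302.6902) of Whiting's mode
stability, proved by an integral
transformation special to Kerr (arXiv:1402.7034 Remark 8.4 and §8.7.4; Ma–Szeftel arXiv:2410.02341
§1.4.4 import it as a black box; Hintz
arXiv:2606.28253 uses mode stability via Teukolsky). The card transplants Willems dissipativity /
KYP / Coppel converse-Lyapunov theory
(doi:10.1007/BF00276493, doi:10.1016/0167-6911(95)00063-1, doi:10.1007/BFb0067780) with an explicit
dictionary (time ↦ r*, storage ↦ Q_𝕄,
supply ↦ horizon/scri fluxes, dissipation inequality ↦ H ⪰ 0): DRSR's hand-built currents Q^f, Ϙ^h,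
ϟ^y, Q^T, Q^K
(`Kerr.virialCurrent` … `Kerr.energyCurrentK`) are single rays of a convex cone of certificates,
superradiance kills only the constant-Im β ray,
and Theorem C says the cone is exhausted exactly by real modes, so construction becomes convex
search (SDP + rational rounding,
doi:10.1016/j.tcs.2008.09.025) and verification becomes algebra the Lean tree can check. Imported
areas: control/dissipativity theory and
SOS-SDP certification (doi:10.1016/j.automatica.2015.12.010); no prior route exists on this summit
and the negatives index is empty.
Rev 2 (cone repair, 2026-08-15): the statements never used any of the DRSR wave-decay named facts
that rode in on the import of
`KerrTortoiseRadius` (11 unproved XL facts of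
BlackHoles/KerrWaveEnergy/KerrWaveDecay/KerrHyperboloidalFlux + Sweep2's Teukolsky boundedness);
the tortoise ODE, the admissibility inequalities and the printed potential are now inlined (provably
equivalent, Bridge.lean evidence), and the
programme items pass through a NON-VACUOUS Kerr-stability waypoint K over `VacuumCauchyDevelopment`
(spelled out inline in both) instead of the vacuous gr.S04.

RANKED CRUXES. #2 CertificateFamily (crux) — card K1 made uniform: ∀ M > 0, 0 ≤ a₀ < M, box (ω_h,
Λ_h), threshold distance ε > 0, core [r₊(1+δ), R_c]: ∃ η > 0 such that for all 0 ≤ a ≤ a₀, every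
tortoise radius function R (dR/dx = Δ(R)/(R² + a²), R > r₊, R → r₊ at −∞, R → ∞ at +∞; =
`Kerr.IsTortoiseRadius`, inlined) and every admissible triple (Λ ≥ |m|(|m|+1), Λ ≥ 2|amω|; =
`Kerr.IsAdmissibleTriple`, inlined) with |ω| ≤ ω_h, Λ ≤ Λ_h, ε ≤ ω, ω + ε ≤ mω₊ there are C¹ α, γ :
ℝ → ℝ, β : ℝ → ℂ with sup-norms ≤ 1, limits at ±∞ (Re β → 0), end inequalities γ₊ + ω²α₊ + 2ωb₊ ≤ 0
and 0 ≤ γ₋ + k₋²α₋ − 2k₋b₋ (k₋ = ω − mω₊), H(x) ⪰ 0 for all x and H(x) ⪰ η𝟙 whenever r₊(1+δ) ≤ R(x)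
≤ R_c, where P = ω² − V(R x), V the printed Carter potential (= `Kerr.sepPotential` by
`Kerr.sepPotential_eq`). [difficulty: L] (why it might fail: Needs (i) radial real-mode exclusion at
EVERY admissible Λ ≤ Λh, not only separation constants (arXiv:1302.6902 Thm 1.6, 1607.02759 Thm 1
cover separated modes only); (ii) slack-free H ⪰ 0 on the non-compact tails, where compact open-cone
duality is silent; (iii) η uniform up to a₀ without slack.) [arXiv:1302.6902, arXiv:1607.02759,
arXiv:1402.7034, doi:10.1007/s00220-020-03796-z]
#3 CertificateCompleteness (support) — Theorem C of the card in the compact model (completeness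
half): for k₊ > 0, k₋ ≠ 0, L > 0 and P continuous on [−L, L], if every C² solution of u'' + Pu = 0
on [−L, L] with u'(L) = ik₊u(L), u'(−L) = −ik₋u(−L) vanishes, then a strict certificate exists: C¹
α, γ, β on ℝ with γ(L) + k₊²α(L) + 2k₊Im β(L) ≤ 0, 0 ≤ γ(−L) + k₋²α(−L) − 2k₋Im β(−L) and H(x) ⪰ η𝟙
(η > 0) on [−L, L]. Open-cone theorem of alternatives (Hahn–Banach against the sup-norm interior of
the PSD cone; the dual PSD matrix measure N with N' = 𝒜N + N𝒜† is forced to rank one on the boundary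
lines, N = zz† with z a real mode); retriaged to support (proof verified, no duality gap).
[difficulty: M] [doi:10.1007/BF00276493, doi:10.1109/TAC.2002.806652,
doi:10.1016/0167-6911(95)00063-1, arXiv:1705.07096]
#5 FinalStateFromKerrCapture (crux) — THE LARGE-DATA HALF, filed coarse on purpose and shared in
substance by every perturbative route: K → the summit statement, where the antecedent K (spelled out
inline) is the sub-extremal Kerr stability conjecture (Dafermos–Rodnianski arXiv:0811.0354 Conj.
5.1, gr.S04) in consequence form over the repaired `VacuumCauchyDevelopment`: ∃ (s, δ, k) ∀
sub-extremal (M, a) ∀ η > 0 ∃ ε > 0: every vacuum-constraint solution on the horizon-penetrating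
Kerr–Schild slice `Kerr.slice a M` (r₀ := M ∈ (r₋, r₊)) within H^s_δ × H^{s−1}_{δ+1} distance ε of
`Kerr.data M a M` has all its maximal vacuum Cauchy developments with (i) final parameters (M′, a′)
sub-extremal and η-close, (ii) complete 𝓘⁺ in the far-origin sojourn form (inlined verbatim from
`DataEmbedding.HasCompleteFutureNullInfinityFar`: ray origins in {‖y‖ ≥ afRadius + 1}; Bridge.lean
`subextremalKerrCapture_iff`), (iii) a region converging in Cᵏ to g_{M′,a′} in the Kerr–Schild
late-chart gauge (`Spacetime.ConvergesToKerr`); the consequent is the summit statement BY NAME, i.e.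
— since the statement re-type T2 (p126844, 2026-08-16; route-repair revs 4–6) — MGHD existence, weak
cosmic censorship and settling for TAME-Christodoulou-generic admissible one-ended data
(`InitialDataSet.IsTameChristodoulouGeneric … 1`: the witness family through a bad datum lives on
ONE fixed end with continuous mass, is `AFEnd.wDist`-continuous and immersed at c = 0 — burial
families à la SwallowTheDatum/KerrBurial are no longer witnesses), asymptotic settling of the domain
of outer communications to finitely many sub-extremal Kerr exteriors moving apart with the settled
region bounded below intrinsically (`Summit.FinalStateConjecture.RaysStayInClosure`), exhaustive
charts with HONEST near-zone radii (Rᵢ(τ) ≥ max(r₊, 0) + 1, Rᵢ → ∞, now inside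
`HasExhaustiveCharts`) and future-oriented chart time
(`Summit.FinalStateConjecture.IsFutureOriented`: orthochronous motions, transported
`Kerr.timeVector` eventually future-directed). This route BUILDS no `HasExhaustiveCharts` witness
and DESTRUCTURES no genericity witness anywhere: all four T2 conjuncts are obligations of this item,
absorbed by name, and `closes := h₃ (h₂ h₁)` re-elaborates unchanged against the re-typed Statement
(lean check rc 0, `#h21_check_closes` ok, axioms propext/Classical.choice/Quot.sound; the cone now
reaches `RaysStayInClosure`, `IsFutureOriented`, `IsOrthochronous`, `AFEnd`). Note the gap the item
carries on purpose: K's (iii) is unoriented `ConvergesToKerr` on a witness-chosen region, so the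
upgrade to the oriented, honestly truncated, exhaustive, ray-closed description of the whole d.o.c.
is part of this item, not of K. Genericity (tame or not) is not closed under conjunction, so WCC is
not peeled off as a separate item here. K is in print for the full sub-extremal range since 06/2026
(Hintz arXiv:2606.28253, 509 pp + two companions, unrefereed; |a| ≪ M: Klainerman–Szeftel; a = 0
codim 3: DHRT) but is not provable in-tree, so the item is strictly weaker than the summit — unlike
rev-1 FinalStateFromKerrStability, whose antecedent was vacuous (item ↔ summit, Bridge.lean
`finalStateFromKerrStability_iff`). [difficulty: open-problem] (why it might fail: it is FSC minus
perturbation theory (post-Hintz: minus a theorem): generic vacuum naked singularities (RSR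
1912.08478 exist non-generically), data with unboundedly many holes, non-merging bound
configurations, parking at extremality (ε(M,a) → 0), or a stationary non-Kerr end state each break
it; post-T2 additionally: witness families must be tame (no burial at infinity), and
`RaysStayInClosure` constrains every future-complete normalised null ray from Σ — an
interior-flavoured clause (retype REPORT §5 Q1) that fails if some MGHD carries a future-complete
null ray from Σ outside closure(d.o.c.).) [arXiv:1710.01722, arXiv:0811.0354,
doi:10.1088/0264-9381/16/12A/302, arXiv:2104.08222, arXiv:1912.08478, arXiv:2606.28253]
#9 CertificatesToKerrCapture (crux; rank 9 = lowest; support 2026-08-15 → crux again 2026-08-16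
under the crux-only ruling, see below) — THE PROGRAMME CLAIM: CertificateFamily → K (the same K,
inline), i.e. the certificate family (with DRSR's currents for |ω| ≤ ω_low, the large-frequency
ranges and the redshift/large-r multipliers, all themselves certificates, plus threshold-adapted
certificates near ω = mω₊ and the Teukolsky analogue) yields integrated decay with certificate
constants on every compact spin range and hence, through the Ma–Szeftel / DHRT / Hintz architecture,
sub-extremal Kerr stability in the tree's form — a Whiting-free derivation. As a bare proposition it
is implied by K, which is in print (Hintz arXiv:2606.28253, unrefereed) but unformalised in-tree;
`closes` takes it as a hypothesis and the crux-only ruling (2026-08-16) admits there only cruxes or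
PROVED lemmas, and it is not provable in-tree short of the programme itself (or of formalising
Hintz), so it is a crux: its mathematical value is provenance (the Whiting-free derivation), its
risk as a proposition is the rendering of K (why it might fail: unweighted Cᵏ sup over entire
Kerr–Schild slabs in `ConvergesToKerr`, far-origin sojourn completeness, the H^s_δ ball on the
horizon-penetrating slice r ≥ M — each could over-ask while certificates exist), which a refuter
should audit against Hintz's main theorem once. Supersedes rev-1 CertificatesToKerrStability
(provable outright by vacuity, Bridge.lean `certificatesToKerrStability_vacuous`). [deps:
CertificateFamily] [difficulty: open-problem] [arXiv:2606.28253, arXiv:2410.02341, arXiv:2603.23437,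
arXiv:2212.14093, arXiv:1402.7034, arXiv:0811.0354]
#9 CertificateEstimate (support) — soundness with source (the energy identity ∫z†Hz = Q(L) − Q(−L) −
∫2Re(F(αū' + β̄ū))): a certificate on [−L, L] with H ⪰ 0, H ⪰ η𝟙 on [c₁, c₂], sup|α|, sup‖β‖ ≤ 1 and
the two end inequalities gives, for every C² u with u'(L) = ik₊u(L), u'(−L) = −ik₋u(−L) and F := u''
+ Pu, the bound η∫_{c₁}^{c₂}(|u'|² + |u|²) ≤ 2∫_{−L}^{L}|F|(|u'| + |u|). Canary for the inlined
certificate predicate; FTC plus 2×2 Hermitian algebra. [difficulty: provable-now] [arXiv:1402.7034,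
doi:10.1007/BF00276493]
#9 CardInstance (support) — the card's "one honest value" K1, a special case of CertificateFamily
(same inlining): M = 1, a₀ = 9/10, |ω| ≤ 2, Λ ≤ 30 (ℓ ≤ 4), threshold distance 1/10, core r ∈
[11r₊/10, 30]; intended closure by SDP synthesis + Peyrl–Parrilo rational rounding + interval
enclosures, checked in Lean by polynomial inequalities. [difficulty: M] [arXiv:1402.7034,
doi:10.1016/j.tcs.2008.09.025]

TWO-LAYER PLAN. Foreseen glued splits (nothing filed now): CertificateFamily ⇐ PointwiseCertificates
(Theorem C on the line with integrable tails + real-mode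
exclusion, or direct SDP witnesses per frequency) → MarginSemicontinuity (η lower semicontinuous in
(a, ω, m, Λ) ⇒ uniform on compacta) →
CertificateFamily. CertificatesToKerrCapture ⇐ ThresholdCertificates (|ω − mω₊| < ε and the
Teukolsky radial ODE) → WhitingFreeILED
(certificates + DRSR §§8.2–8.7.3, §9 ⇒ integrated local energy decay with certificate constants — to
be filed as an ITEM stated over the
Kerr-wave vocabulary when split, deliberately NOT by importing the named fact
`drsr_wave_integrated_decay_kerr`, whose module would put eleven
unproved XL facts back into the cone) → (ILED ⇒ K, the Ma–Szeftel/Hintz architecture).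
FinalStateFromKerrCapture ⇐
GenericCompleteNullInfinity → SettlingGivenCompleteness (with the codimension bookkeeping that
genericity of a conjunction needs) →
FinalStateFromKerrCapture.

KILL CRITERIA. A mode-free frequency (toy or Kerr) at which the discretised certificate SDP is
infeasible with margin stable under grid refinement refutes
CertificateCompleteness in spirit and CertificateFamily in fact: close `refuted:CertificateFamily`.
A proof that the optimal normalised margin at
a = 0.9M, ℓ ≤ 4 is below, say, 10⁻¹² (certificate degree beyond reach) does not refute the crux but
retires CardInstance and forces a pivot to
"existence by Theorem C + mode stability" (losing the Whiting-free point: then close `superseded` in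
favour of a plain DRSR formalisation
route). ¬CertificateCompleteness (a duality gap) kills the line outright. A refutation of the
waypoint K as rendered (truncated slice, sojourn
form) would make FinalStateFromKerrCapture vacuously true and CertificatesToKerrCapture equivalent
to ¬CertificateFamily, for reasons outside the card:
restate both against the repaired rendering. FSC-level refutations (FinalStateFromKerrCapture) moot
every route of the summit alike.

NOT DECOMPOSED YET. Threshold frequencies ω → 0⁺ and ω → mω₊ (DRSR's |ω| ≤ ω_low currents are
certificates; the threshold ω = mω₊ needs k₋ → 0 adapted end
conditions), the mirror branch ω < 0 < m reversed (complex conjugation), a < 0 (φ ↦ −φ), the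
Teukolsky (spin ±2) radial ODE, the complexity
law d(a₀) → ∞ as a₀ → M (card K3; consistent with `AretakisInstability`, deliberately not an item),
the passage certificates ⇒ physical-space
ILED (DRSR §9 summation, a formalisation task), and the whole interior of the large-data half
(FinalStateFromKerrCapture), including its T2 upgrade layer (foreseen as support-level glue once
K-level settling is in hand, NOT filed now: orientation of honest Kerr–Schild late charts from
`Kerr.timeVector` being future timelike for the background, g(V,V) = −1 − 2H; honest growing radii
from near-zone decay on {r ≤ R(τ)} with R(τ) → ∞ slowly; exhaustion and `RaysStayInClosure` from
complete 𝓘⁺ plus finite affine reach of interior null rays inside the MGHD). Constants (ω_h, Λ_h, ε,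
δ, R_c dependence of η) are existential on purpose.

CHEAPEST FALSIFIER. Run the card's staged toy (never executed: compute socket absent in the ideating
session and not attempted here — planners do not compute):
`kit compute submit toyA --entry "python3 main.py"` from the card author's folder, or re-implement:
P = Ω(x)² − V₀sech²x, Ω = ω − ω₀(1 − tanh(x/L))/2,
outgoing both ends, grid certificate feasibility (4 grid functions, pointwise 2×2 PSD with margin,
the two end inequalities in THIS route's sign
convention: γ₊ + k₊²α₊ + 2k₊b₊ ≤ 0 ≤ γ₋ + k₋²α₋ − 2k₋b₋) by SDP/SOCP with bisection on η over V₀ ∈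
{1/4,…,8} × ω/ω₀ ∈ {0.1,…,0.9}. Prediction:
η* > 0 at every mode-free grid point, small exactly where the horizon-normalised solution is nearly
outgoing at infinity. One mode-free point
with η* = 0 stable under refinement kills the line. Second cheapest: CertificateEstimate in Lean (a
day), which validates the inlined predicate.

NUMBERS. Card instance: M = 1, a₀ = 0.9 (r₊ = 1.436, ω₊ = a/(2Mr₊) = 0.313), box |ω| ≤ 2, Λ ≤ 30 (so
|m| ≤ 5), thresholds ε = 0.1 (m = 1 window
ω ∈ [0.1, 0.213]), core r ∈ [1.1 r₊, 30]. Slowly damped bounded-frequency Kerr QNMs at a = 0.9M have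
|Im ω|M ≈ 0.03–0.08 (card), the scale
that sets the expected optimal margin. DRSR's mode-stability input covers exactly {ω_low ≤ |ω| ≤
ω_high, Λ ≤ ε_width⁻¹ω_high²}
(arXiv:1402.7034 Remark 8.4, Prop. 8.7.4). Items after the T2 route-repair (revs 4–6, 2026-08-16): 7
— 3 cruxes (CertificateFamily rank 2, FinalStateFromKerrCapture 5, CertificatesToKerrCapture 9), 3
support (CertificateCompleteness, CertificateEstimate, CardInstance) and the assembly, restated in
rev 6 as the frame statement X → summit, `CertificateFamily ∧ CertificateCompleteness →
FinalStateConjecture` (provable exactly from the two programme cruxes; the rev-2 chain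
CertificateFamily → CertificatesToKerrCapture → FinalStateFromKerrCapture → FinalStateConjecture is
the type of `closes` itself, closed by `tauto`, and was flagged ground.trivial by the grounding
battery). Import cone after rev 2: the sub-problem
Statement's own closure + `KerrTimelikeSpan` (no named facts) + `WeightedNorms` (6 named facts, all
discharged) — 15 → 3 unproved cone facts,
the residual 3 being the Statement's own (Causality.lean:
`isGloballyHyperbolic_iff_exists_isCauchySurface`,
`IsGloballyHyperbolic.isStronglyCausal`, `IsGloballyHyperbolic.isClosed_causalFuture`, all over the
misformalised `IsCauchySurface`, refuted
in-tree by `CausalityProofs`, never dischargeable, shared by every route of the summit).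

DEFINITION REQUESTS. None filed: the certificate predicate is inlined (one-line Props over
`Kerr.rPlus`, `Kerr.horizonAngularVelocity`, the printed
potential and the tortoise ODE; the waypoint over `Kerr.slice`, `Kerr.data`, `Kerr.afRadius`,
`InitialDataSet.dataWeightedSobolevEDist`,
`VacuumCauchyDevelopment(.IsMaximal)`, `LorentzianMetric.IsNormalisedNullRayFrom`, `sojournTime`,
`LorentzianMetric.causalFuture`,
`Spacetime.ConvergesToKerr`, all found by `lean search --decl`). If provers want it, a later
`LocalCertificate P k₊ k₋ η` / `IsRealMode P k₊ k₋`
definition under Literature/Analysis/ODE would shorten every item, and a fact-free home for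
`Kerr.IsTortoiseRadius` / `Kerr.sepPotential` /
`Kerr.delta` (today `KerrTortoiseRadius` / `KerrSeparatedPotential` / `Sweep2`, whose closures carry
unproved XL facts) would let the items
use the names again; not needed now. needs-fact: NONE of the 15 facts listed by the cone census is
used by any item.

Novelty: Searches (2026-08-15): `lit search --source arxiv "nonlinear stability Kerr full subextremal range"
--year-from 2023` (3: arXiv:2606.28253 Hintz,
arXiv:2410.02341 and arXiv:2603.23437 Ma–Szeftel — NOT on the card); `lit frontier
FinalStateConjecture --since 2023` (30 rows; arXiv:2212.14093
DHRT quasilinear on Kerr; nothing on certificates); `lit search --source crossref "semidefinite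
programming Morawetz multiplier Kerr
superradiant"` (10 generic SDP rows, none PDE/GR); `lit galaxy search "Morawetz estimate sum of
squares certificate" --star all` (0) and
`"dissipativity storage function wave equation black hole" --star all` (0); `lit galaxy search
--star pdf --mode intelligent "semidefinite
programming or sum-of-squares certificates for Morawetz … Kerr … superradiance"` (10:
Andersson–Blue, ABB, Aretakis, theses — hand multipliers
only); held DRSR-III grep for "mode stability|ω_low" (Remark 8.4, §8.7.1–8.7.4 located); Ma–Szeftel
pp. 8–10 read (bounded-frequency control
imported from DRSR as a black box). Plus the card's and the novelty audit's searches (zbMATH 0,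
Crossref 24 disjoint rows).
Nearest prior art found: arXiv:1402.7034 (every hand current is a point of the cone; bounded regime
closed only via arXiv:1302.6902);
arXiv:2606.28253 and arXiv:2410.02341 (full-range nonlinear/robust theory, still importing mode
stability); doi:10.1016/j.automatica.2015.12.010
(SOS storage functionals for PDE dissipation inequalities, no outgoing ends);
doi:10.1007/BF00276493, doi:10.1007  [refs: 10.1016/j.automatica.2015.12.010, 10.1007/BF00276493, 10.1007/BFb0067780, 2606.28253, 2410.02341, 2603.23437, 2212.14093, 1402.7034, 1302.6902, 1705.07096, doi:10.1016/j.automatica.2015.12.010, doi:10.1007/BF00276493, doi:10.1007/BFb0067780]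

Barriers (technique_class: kerr-stability, vectorfield-method, SOS-certificates): - technique_class: kerr-stability, vectorfield-method, SOS-certificates
- Literature.Barriers.FinalStateConjecture.KerrSuperradiance: evaded — no timelike Killing
combination or positive conserved energy is used; positivity is demanded of H_𝕄 for
frequency-dependent non-Noetherian 𝕄, and the superradiant flux sign removes only the constant-Im β
ray of the cone (the flux-climb budget (Im β')² ≤ (α'+2Re β)(γ'−2P Re β) is how the line pays for
it).
- Literature.Barriers.FinalStateConjecture.SlowlyRotatingKerrFrontier: attacked head-on at the
linear level — certificates are synthesised at each a₀ < M with no small parameter; the nonlinear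
passage (crux 4) now leans on arXiv:2606.28253 / arXiv:2410.02341 rather than on smallness; the bet
is that certificate degree is reachable at a₀ ≈ 0.9M.
- Literature.Barriers.FinalStateConjecture.KleinGordonSuperradiantInstability: consistent — a
certificate is for the exact massless shell P(·; μ² = 0) and carries an explicit robustness radius
in P, which the growing massive modes force to shrink in the direction μ² > 0: the method is
mass-sensitive by construction.
- Literature.Barriers.FinalStateConjecture.KerrLinearHair: same answer as for the Klein–Gordon
barrier; stationary linear hair lives at ω = 0 / threshold frequencies, which crux 2 excludes
(ε-away) and the two-layer plan isolates as ThresholdCertificates.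
- Literature.Barriers.FinalStateConjecture.SbierskiTrappingObstruction: not engaged — bounded
frequencies only; at high frequency

History (route lifecycle, newest last):
- 2026-08-15T16:32:18Z · rev 2: restated CertificateFamily (stmt-FinalStateConjecture-9931), CardInstance (stmt-FinalStateConjecture-9941), Assembly (stmt-FinalStateConjecture-9942) — cone repair (route-repair unit rrepair-FinalStateConjecture-StorageCe-4be93e85-g2): imports [KerrTortoiseRadius, Stability] → [KerrTimelikeSpan, WeightedNorms]; (planner-rrepair-FinalStateConjecture-StorageCe-4be93e85-g2-0)
- 2026-08-15T16:32:18Z · rev 2: dropped stmt-FinalStateConjecture-9930, stmt-FinalStateConjecture-9933, stmt-FinalStateConjecture-9934 — cone repair (route-repair unit rrepair-FinalStateConjecture-StorageCe-4be93e85-g2): imports [KerrTortoiseRadius, Stability] → [KerrTimelikeSpan, WeightedNorms]; (planner-rrepair-FinalStateConjecture-StorageCe-4be93e85-g2-0)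
- 2026-08-16T23:16:51Z · rev 6: restated Assembly (stmt-FinalStateConjecture-10927) — @note4.txt (planner-rrepair-FinalStateConjecture-StorageCe-287e7e62-0)
- 2026-08-23T09:42:55Z · DORMANT — reconciler: no traction for 6 d (last activity statement-grounded at 2026-08-17T08:01:29Z); parked, not closed — `ledger route dormant route-FinalStateConjectur (operator:999:2680089)

sub-problem: FinalStateConjecture · status: dormant · opened planner-plancard-FinalStateConjecture-FinalSt-39c9ce90-0 2026-08-15T14:56:58Z · rev 10 · ledger route-FinalStateConjecture-StorageCertificates
GENERATED by the gate from the ledger (D-0016/17). Provers cite these decls: `theorem foo : Summit.FinalStateConjecture.FinalStateConjecture.Theses.StorageCertificates.<Decl> := …` in Summits/FinalStateConjecture/FinalStateConjecture/Theorems/<Name>.lean.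
-/

namespace Summit.FinalStateConjecture.FinalStateConjecture.Theses.StorageCertificates

open scoped BigOperators Topology Manifold Classical MeasureTheory ProbabilityTheory Matrix InnerProductSpace ComplexConjugate ContinuousMap
open Filter Set Function TopologicalSpace MeasureTheory

attribute [summit_statement] _root_.FinalStateConjecture

-- earlier CertificateFamily (stmt-FinalStateConjecture-9931, replaced 2026-08-15T16:32:18Z -> stmt-FinalStateConjecture-10925): retired by None — ∀ (M a₀ : ℝ), 0 < M → 0 ≤ a₀ → a₀ < M → ∀ (ωh Λh ε δ Rc : ℝ), 0 < ε → 0 < δ → ∃ η : ℝ, 0 < η ∧ ∀ (a : ℝ), 0 ≤ a → a ≤ a₀ → ∀ (R : ℝ → ℝ), Literature.Geometry.Lorentzian.Kerr.IsTortoiseRadius M a R → ∀ (ω Λ : ℝ) (m : ℤ), Literature.Geometry.Lorentzian.Kerr.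
/-- item stmt-FinalStateConjecture-10925 · crux · rank 2 · open · by planner
why it might fail: Needs (i) radial real-mode exclusion at EVERY admissible Λ ≤ Λh, not only separation constants (arXiv:1302.6902 Thm 1.6, 1607.02759 Thm 1 cover separated modes only); (ii) slack-free H ⪰ 0 on the non-compact tails, where compact open-cone duality is silent; (iii) η uniform up to a₀ without slack.
sources: arXiv:1302.6902, arXiv:1607.02759, arXiv:1402.7034, doi:10.1007/s00220-020-03796-z
[crux] card K1 made uniform: ∀ M > 0, 0 ≤ a₀ < M, box (ω_h, Λ_h), threshold distance ε > 0, core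
[r₊(1+δ), R_c]: ∃ η > 0 such that for all 0 ≤ a ≤ a₀, every tortoise radius function R (dR/dx =
Δ(R)/(R² + a²) with Δ = R² − 2MR + a², R > r₊, R → r₊ at −∞, R → ∞ at +∞ — the fields of
`Kerr.IsTortoiseRadius M a R`, inlined) and every admissible triple (Λ ≥ |m|(|m|+1), Λ ≥ 2|amω| —
`Kerr.IsAdmissibleTriple`, inlined) with |ω| ≤ ω_h, Λ ≤ Λ_h, ε ≤ ω, ω + ε ≤ mω₊ there are C¹ α, γ :
ℝ → ℝ, β : ℝ → ℂ with sup-norms ≤ 1, limits at ±∞ (Re β → 0), end inequalities γ₊ + ω²α₊ + 2ωb₊ ≤ 0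
and 0 ≤ γ₋ + k₋²α₋ − 2k₋b₋ (k₋ = ω − mω₊), H(x) ⪰ 0 for all x and H(x) ⪰ η𝟙 whenever r₊(1+δ) ≤ R(x)
≤ R_c, where P = ω² − V(R x) and V is the printed Carter potential of arXiv:1402.7034 §5.2.3 (=
`Kerr.sepPotential M a ω m Λ` by `Kerr.sepPotential_eq`, inlined). Rev 2: light restatement,
provably equivalent to rev 1 (planner evidence Bridge.lean, `certificateFamily_iff`); it needs only
`KerrTimelikeSpan`. [difficulty: L] -/
@[route_item "route-FinalStateConjecture-StorageCertificates", crux]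
def CertificateFamily : Prop :=
  ∀ (M a₀ : ℝ), 0 < M → 0 ≤ a₀ → a₀ < M → ∀ (ωh Λh ε δ Rc : ℝ), 0 < ε → 0 < δ → ∃ η : ℝ, 0 < η ∧ ∀ (a : ℝ), 0 ≤ a → a ≤ a₀ → ∀ (R : ℝ → ℝ), (∀ x, HasDerivAt R (((R x) ^ 2 - 2 * M * R x + a ^ 2) / ((R x) ^ 2 + a ^ 2)) x) → (∀ x, Literature.Geometry.Lorentzian.Kerr.rPlus M a < R x) → Filter.Tendsto R Filter.atBot (nhds (Literature.Geometry.Lorentzian.Kerr.rPlus M a)) → Filter.Tendsto R Filter.atTop Filter.atTop → ∀ (ω Λ : ℝ) (m : ℤ), |(m : ℝ)| * (|(m : ℝ)| + 1) ≤ Λ → 2 * |a * m * ω| ≤ Λ → |ω| ≤ ωh → Λ ≤ Λh → ε ≤ ω → ω + ε ≤ m * Literature.Geometry.Lorentzian.Kerr.horizonAngularVelocity M a → ∃ (α γ α₁ γ₁ : ℝ → ℝ) (β β₁ : ℝ → ℂ) (αp bp γp αm bm γm : ℝ), (∀ x, HasDerivAt α (α₁ x) x ∧ HasDerivAt γ (γ₁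 x) x ∧ HasDerivAt β (β₁ x) x) ∧ Continuous α₁ ∧ Continuous γ₁ ∧ Continuous β₁ ∧ (∀ x, |α x| ≤ 1 ∧ |γ x| ≤ 1 ∧ ‖β x‖ ≤ 1) ∧ Filter.Tendsto α Filter.atTop (nhds αp) ∧ Filter.Tendsto (fun x ↦ (β x).im) Filter.atTop (nhds bp) ∧ Filter.Tendsto γ Filter.atTop (nhds γp) ∧ Filter.Tendsto (fun x ↦ (β x).re) Filter.atTop (nhds 0) ∧ Filter.Tendsto α Filter.atBot (nhds αm) ∧ Filter.Tendsto (fun x ↦ (β x).im) Filter.atBot (nhds bm) ∧ Filter.Tendsto γ Filter.atBot (nhds γm) ∧ Filter.Tendsto (fun x ↦ (β x).re) Filter.atBot (nhds 0) ∧ γp + ω ^ 2 * αp + 2 * ω * bp ≤ 0 ∧ 0 ≤ γm + (ω - m * Literature.Geometry.Lorentzian.Kerr.horizonAngularVelocity M a) ^ 2 * αm - 2 * (ω - m * Literature.Geometry.Lorentzian.Kerr.horizonAngularVelocity M a) * bm ∧ ∀ (x r P h11 h22 : ℝ) (h12 : ℂ), r = R x → P = ω ^ 2 - ((4 * M * r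 * a * m * ω - a ^ 2 * (m : ℝ) ^ 2 + (r ^ 2 - 2 * M * r + a ^ 2) * Λ) / (r ^ 2 + a ^ 2) ^ 2 + (r ^ 2 - 2 * M * r + a ^ 2) * (3 * r ^ 2 - 4 * M * r + a ^ 2) / (r ^ 2 + a ^ 2) ^ 3 - 3 * (r ^ 2 - 2 * M * r + a ^ 2) ^ 2 * r ^ 2 / (r ^ 2 + a ^ 2) ^ 4) → h11 = α₁ x + 2 * (β x).re → h22 = γ₁ x - 2 * P * (β x).re → h12 = β₁ x + ((γ x - α x * P : ℝ) : ℂ) → (0 ≤ h11 ∧ 0 ≤ h22 ∧ ‖h12‖ ^ 2 ≤ h11 * h22) ∧ (Literature.Geometry.Lorentzian.Kerr.rPlus M a * (1 + δ) ≤ r → r ≤ Rc → η ≤ h11 ∧ η ≤ h22 ∧ ‖h12‖ ^ 2 ≤ (h11 - η) * (h22 - η))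

/-- item stmt-FinalStateConjecture-10929 · crux · rank 5 · open · by planner
why it might fail: FSC minus a printed theorem: generic naked singularities, unboundedly many holes, non-merging clusters, parking at extremality, non-Kerr stationary ends; post-T2: only TAME witness families count, and RaysStayInClosure fails if an MGHD has a future-complete null ray from the data off closure(doc).
sources: arXiv:1710.01722, arXiv:0811.0354, doi:10.1088/0264-9381/16/12A/302, arXiv:2104.08222, arXiv:1912.08478, arXiv:2606.28253
[crux] THE LARGE-DATA HALF, filed coarse on purpose and shared in substance by every perturbative
route: K → FinalStateConjecture, where the antecedent K — spelled out inline — is the sub-extremal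
Kerr stability conjecture (Dafermos–Rodnianski arXiv:0811.0354 Conj. 5.1; gr.S04
`SubextremalKerrStabilityConjecture` is vacuous over the uninhabited vendored `VacuumDevelopment`)
in consequence form over the repaired, inhabited `VacuumCauchyDevelopment` (the structure the summit
statement uses): ∃ (s, δ, k) ∀ sub-extremal (M, a) ∀ η > 0 ∃ ε > 0: every vacuum-constraint solution
D on the horizon-penetrating Kerr–Schild slice `Kerr.slice a M` (r₀ := M ∈ (r₋, r₊)) with
dataWeightedSobolevEDist s δ D (Kerr.data M a M) < ε has all its maximal vacuum Cauchy developments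
with (i) final parameters (M′, a′) sub-extremal, |M′ − M| + |a′ − a| ≤ η, (ii) complete 𝓘⁺ in the
far-origin sojourn form, inlined verbatim from `DataEmbedding.HasCompleteFutureNullInfinityFar` (ray
origins in {‖y‖ ≥ afRadius a M + 1}; planner evidence Bridge.lean `subextremalKerrCapture_iff`;
inlined because `StabilityCauchy`/`ModelData` carry an undischargeable cone fact), (iii) a region
𝒟oc converging in Cᵏ to g_{M′,a′} in t -/
@[route_item "route-FinalStateConjecture-StorageCertificates", crux]
def FinalStateFromKerrCapture : Prop :=
  (∀ [Literature.Geometry.Lorentzian.Kerr.Facts] [Literature.Geometry.Lorentzian.Kerr.SliceFacts], ∃ (s : ℕ) (δ : ℝ) (k : ℕ), ∀ (M a : ℝ) (h : Literature.Geometry.Lorentzian.Kerr.IsSubextremal M a), ∀ η > (0 : ℝ), ∃ ε > (0 : ℝ), ∀ (D : Literature.Geometry.Lorentzian.InitialDataSet 𝓘(ℝ, Literature.Geometry.Lorentzian.E3) (Literature.Geometry.Lorentzian.Kerr.slice a M)) [D.metric.HasLeviCivita], D.IsVacuumConstraintSolution → Literature.Geometry.Lorentzian.InitialDataSet.dataWeightedSobolevEDist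 s δ D (Literature.Geometry.Lorentzian.Kerr.data M a M h.pos.le) < ENNReal.ofReal ε → ∀ 𝒟 : Literature.Geometry.Lorentzian.VacuumCauchyDevelopment D, 𝒟.IsMaximal → ∃ (M' a' : ℝ) (𝒟oc : Set 𝒟.carrier), Literature.Geometry.Lorentzian.Kerr.IsSubextremal M' a' ∧ |M' - M| + |a' - a| ≤ η ∧ (∀ [𝒟.metric.HasLeviCivita], ∃ B₀ : Set (Literature.Geometry.Lorentzian.Kerr.slice a M), IsCompact B₀ ∧ ∀ σ : ℝ, 0 < σ → ∃ B₁ : Set (Literature.Geometry.Lorentzian.Kerr.slice a M), IsCompact B₁ ∧ ∀ p : Literature.Geometry.Lorentzian.Kerr.slice a M, Literature.Geometry.Lorentzian.Kerr.afRadius a M + 1 ≤ ‖(p : Literature.Geometry.Lorentzian.E3)‖ → p ∉ B₁ → ∀ (γ : ℝ → 𝒟.carrier) (dom : Set ℝ), 𝒟.metric.IsNormalisedNullRayFrom 𝒟.timeOrientation 𝒟.embed 𝒟.normal p γ dom → ¬ BddAbove dom ∨ ENNReal.ofReal σ ≤ Literature.Geometry.Lorentzian.sojournTime γ dom (𝒟.metric.causalFuture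 𝒟.timeOrientation (𝒟.embed '' B₀))) ∧ 𝒟.toSpacetime.ConvergesToKerr 𝒟oc M' a' k) → FinalStateConjecture

/-- item stmt-FinalStateConjecture-10928 · crux · rank 9 · open · by planner
why it might fail: Holds outright once K-as-rendered holds (Hintz arXiv:2606.28253, unrefereed); fails iff the rendering of K over-asks while certificates exist: unweighted Cᵏ sup over ENTIRE Kerr–Schild slabs out to i⁰ (`ConvergesToKerr`), far-origin sojourn completeness, H^s_δ-smallness on the slice r ≥ M.
sources: arXiv:2606.28253, arXiv:2104.08222, arXiv:2410.02341, arXiv:1402.7034, arXiv:0811.0354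
[support] THE PROGRAMME CLAIM: CertificateFamily → K, with the same K (the non-vacuous sub-extremal
Kerr stability statement over `VacuumCauchyDevelopment`, see FinalStateFromKerrCapture) spelled out
inline — the certificate family (with DRSR's currents for |ω| ≤ ω_low, the large-frequency ranges
and the redshift/large-r multipliers, all themselves certificates, plus threshold-adapted
certificates near ω = mω₊ and the Teukolsky analogue) yields integrated decay with certificate
constants on every compact spin range and hence, through the Ma–Szeftel / DHRT / Hintz architecture,
sub-extremal Kerr stability in the tree's form: a Whiting-free derivation. As a proposition it is
implied by K, which is in print (Hintz arXiv:2606.28253), hence support; its value is provenance; a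
refuter should audit the rendering of K (truncated slice, H^s_δ data ball, sojourn completeness,
late-chart gauge) against Hintz's main theorem once. Supersedes rev-1 CertificatesToKerrStability,
which was provable outright by vacuity (Bridge.lean `certificatesToKerrStability_vacuous`). K is
deliberately not a separate item: the gate renders items by kind and rank, so a crux could not cite
a support item by name. [ -/
@[route_item "route-FinalStateConjecture-StorageCertificates", crux]
def CertificatesToKerrCapture : Prop :=
  CertificateFamily → ∀ [Literature.Geometry.Lorentzian.Kerr.Facts] [Literature.Geometry.Lorentzian.Kerr.SliceFacts], ∃ (s : ℕ) (δ : ℝ) (k : ℕ), ∀ (M a : ℝ) (h : Literature.Geometry.Lorentzian.Kerr.IsSubextremal M a), ∀ η > (0 : ℝ), ∃ ε > (0 : ℝ), ∀ (D : Literature.Geometry.Lorentzian.InitialDataSet 𝓘(ℝ, Literature.Geometry.Lorentzian.E3) (Literature.Geometry.Lorentzian.Kerr.slice a M)) [D.metric.HasLeviCivita], D.IsVacuumConstraintSolution → Literature.Geometry.Lorentzian.InitialDataSet.dataWeightedSobolevEDist s δ D (Literature.Geometry.Lorentzian.Kerr.data M a M h.pos.le) < ENNReal.ofReal ε → ∀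 𝒟 : Literature.Geometry.Lorentzian.VacuumCauchyDevelopment D, 𝒟.IsMaximal → ∃ (M' a' : ℝ) (𝒟oc : Set 𝒟.carrier), Literature.Geometry.Lorentzian.Kerr.IsSubextremal M' a' ∧ |M' - M| + |a' - a| ≤ η ∧ (∀ [𝒟.metric.HasLeviCivita], ∃ B₀ : Set (Literature.Geometry.Lorentzian.Kerr.slice a M), IsCompact B₀ ∧ ∀ σ : ℝ, 0 < σ → ∃ B₁ : Set (Literature.Geometry.Lorentzian.Kerr.slice a M), IsCompact B₁ ∧ ∀ p : Literature.Geometry.Lorentzian.Kerr.slice a M, Literature.Geometry.Lorentzian.Kerr.afRadius a M + 1 ≤ ‖(p : Literature.Geometry.Lorentzian.E3)‖ → p ∉ B₁ → ∀ (γ : ℝ → 𝒟.carrier) (dom : Set ℝ), 𝒟.metric.IsNormalisedNullRayFrom 𝒟.timeOrientation 𝒟.embed 𝒟.normal p γ dom → ¬ BddAbove dom ∨ ENNReal.ofReal σ ≤ Literature.Geometry.Lorentzian.sojournTime γ dom (𝒟.metric.causalFuture 𝒟.timeOrientation (𝒟.embed '' B₀))) ∧ 𝒟.toSpacetime.ConvergesToKerr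 𝒟oc M' a' k

/-- item stmt-FinalStateConjecture-9932 · support · rank 3 · open · by planner
why it might fail: a duality gap: C¹ certificates vs measure-valued duals, and in the superradiant sign (k₋ < 0) strict bulk margin must also buy strict boundary inequalities; if the dual cone is not exhausted by two-solution mixtures the converse fails.
sources: doi:10.1007/BF00276493, doi:10.1109/TAC.2002.806652, doi:10.1016/0167-6911(95)00063-1, arXiv:1705.07096, Mathlib:geometric_hahn_banach_open, Mathlib:RealRMK.rieszMeasure
[crux] Theorem C of the card in the compact model (completeness half): for k₊ > 0, k₋ ≠ 0, L > 0 and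
P continuous on [−L, L], if every C² solution of u'' + Pu = 0 on [−L, L] with u'(L) = ik₊u(L),
u'(−L) = −ik₋u(−L) vanishes, then a strict certificate exists: C¹ α, γ, β on ℝ with γ(L) + k₊²α(L) +
2k₊Im β(L) ≤ 0, 0 ≤ γ(−L) + k₋²α(−L) − 2k₋Im β(−L) and H(x) ⪰ η𝟙 (η > 0) on [−L, L]. Proof sketch
checked by hand: Hahn–Banach against the sup-norm interior of the PSD cone; the dual is a PSD matrix
measure N with N' = 𝒜N + N𝒜†, forced to rank one on the two boundary lines, i.e. N = zz† with z a
real mode. [difficulty: M] -/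
@[route_item "route-FinalStateConjecture-StorageCertificates"]
def CertificateCompleteness : Prop :=
  ∀ (kp km L : ℝ) (P : ℝ → ℝ), 0 < kp → km ≠ 0 → 0 < L → ContinuousOn P (Set.Icc (-L) L) → (∀ (u u₁ : ℝ → ℂ), (∀ x, HasDerivAt u (u₁ x) x) → (∀ x ∈ Set.Icc (-L) L, HasDerivAt u₁ (-((P x : ℝ) : ℂ) * u x) x) → u₁ L = Complex.I * kp * u L → u₁ (-L) = -(Complex.I * km) * u (-L) → ∀ x ∈ Set.Icc (-L) L, u x = 0) → ∃ (α γ α₁ γ₁ : ℝ → ℝ) (β β₁ : ℝ → ℂ) (η : ℝ), 0 < η ∧ (∀ x, HasDerivAt α (α₁ x) x ∧ HasDerivAt γ (γ₁ x) x ∧ HasDerivAt β (β₁ x) x) ∧ Continuous α₁ ∧ Continuous γ₁ ∧ Continuous β₁ ∧ γ L + kp ^ 2 * α L + 2 * kp * (β L).im ≤ 0 ∧ 0 ≤ γ (-L) + km ^ 2 * α (-L) - 2 * km * (β (-L)).im ∧ ∀ x ∈ Set.Icc (-L) L, ∀ (h11 h22 : ℝ) (h12 : ℂ), h11 = α₁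 x + 2 * (β x).re → h22 = γ₁ x - 2 * P x * (β x).re → h12 = β₁ x + ((γ x - α x * P x : ℝ) : ℂ) → η ≤ h11 ∧ η ≤ h22 ∧ ‖h12‖ ^ 2 ≤ (h11 - η) * (h22 - η)

-- earlier CardInstance (stmt-FinalStateConjecture-9941, replaced 2026-08-15T16:32:18Z -> stmt-FinalStateConjecture-10926): retired by None — ∃ η : ℝ, 0 < η ∧ ∀ (a : ℝ), 0 ≤ a → a ≤ 9 / 10 → ∀ (R : ℝ → ℝ), Literature.Geometry.Lorentzian.Kerr.IsTortoiseRadius 1 a R → ∀ (ω Λ : ℝ) (m : ℤ), Literature.Geometry.Lorentzian.Kerr.IsAdmissibleTriple a ω m Λ → |ω| ≤ 2 → Λ ≤ 30 → 1 / 10 ≤ ω → ω + 1 / 10 ≤ m * L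
/-- item stmt-FinalStateConjecture-10926 · support · rank 9 · open · by planner
sources: arXiv:1402.7034, doi:10.1016/j.tcs.2008.09.025
[support] the card's "one honest value" K1, a special case of CertificateFamily (same inlining;
`example` in Sketch.lean): M = 1, a₀ = 9/10, |ω| ≤ 2, Λ ≤ 30 (ℓ ≤ 4), threshold distance 1/10, core
r ∈ [11r₊/10, 30]; intended closure by SDP synthesis + Peyrl–Parrilo rational rounding + interval
enclosures, checked in Lean by polynomial inequalities. Rev 2: light restatement, provably
equivalent to rev 1 (Bridge.lean `cardInstance_iff`). [difficulty: M] -/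
@[route_item "route-FinalStateConjecture-StorageCertificates"]
def CardInstance : Prop :=
  ∃ η : ℝ, 0 < η ∧ ∀ (a : ℝ), 0 ≤ a → a ≤ 9 / 10 → ∀ (R : ℝ → ℝ), (∀ x, HasDerivAt R (((R x) ^ 2 - 2 * 1 * R x + a ^ 2) / ((R x) ^ 2 + a ^ 2)) x) → (∀ x, Literature.Geometry.Lorentzian.Kerr.rPlus 1 a < R x) → Filter.Tendsto R Filter.atBot (nhds (Literature.Geometry.Lorentzian.Kerr.rPlus 1 a)) → Filter.Tendsto R Filter.atTop Filter.atTop → ∀ (ω Λ : ℝ) (m : ℤ), |(m : ℝ)| * (|(m : ℝ)| + 1) ≤ Λ → 2 * |a * m * ω| ≤ Λ → |ω| ≤ 2 → Λ ≤ 30 → 1 / 10 ≤ ω → ω + 1 / 10 ≤ m * Literature.Geometry.Lorentzian.Kerr.horizonAngularVelocity 1 a → ∃ (α γ α₁ γ₁ : ℝ → ℝ) (β β₁ : ℝ → ℂ) (αp bp γp αm bm γm : ℝ), (∀ x, HasDerivAt α (α₁ x) x ∧ HasDerivAt γ (γ₁ x) x ∧ HasDerivAt β (β₁ x) x) ∧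 Continuous α₁ ∧ Continuous γ₁ ∧ Continuous β₁ ∧ (∀ x, |α x| ≤ 1 ∧ |γ x| ≤ 1 ∧ ‖β x‖ ≤ 1) ∧ Filter.Tendsto α Filter.atTop (nhds αp) ∧ Filter.Tendsto (fun x ↦ (β x).im) Filter.atTop (nhds bp) ∧ Filter.Tendsto γ Filter.atTop (nhds γp) ∧ Filter.Tendsto (fun x ↦ (β x).re) Filter.atTop (nhds 0) ∧ Filter.Tendsto α Filter.atBot (nhds αm) ∧ Filter.Tendsto (fun x ↦ (β x).im) Filter.atBot (nhds bm) ∧ Filter.Tendsto γ Filter.atBot (nhds γm) ∧ Filter.Tendsto (fun x ↦ (β x).re) Filter.atBot (nhds 0) ∧ γp + ω ^ 2 * αp + 2 * ω * bp ≤ 0 ∧ 0 ≤ γm + (ω - m * Literature.Geometry.Lorentzian.Kerr.horizonAngularVelocity 1 a) ^ 2 * αm - 2 * (ω - m * Literature.Geometry.Lorentzian.Kerr.horizonAngularVelocity 1 a) * bm ∧ ∀ (x r P h11 h22 : ℝ) (h12 : ℂ), r = R x → P = ω ^ 2 - ((4 * 1 * r * a * m * ω - a ^ 2 * (m : ℝ)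 ^ 2 + (r ^ 2 - 2 * 1 * r + a ^ 2) * Λ) / (r ^ 2 + a ^ 2) ^ 2 + (r ^ 2 - 2 * 1 * r + a ^ 2) * (3 * r ^ 2 - 4 * 1 * r + a ^ 2) / (r ^ 2 + a ^ 2) ^ 3 - 3 * (r ^ 2 - 2 * 1 * r + a ^ 2) ^ 2 * r ^ 2 / (r ^ 2 + a ^ 2) ^ 4) → h11 = α₁ x + 2 * (β x).re → h22 = γ₁ x - 2 * P * (β x).re → h12 = β₁ x + ((γ x - α x * P : ℝ) : ℂ) → (0 ≤ h11 ∧ 0 ≤ h22 ∧ ‖h12‖ ^ 2 ≤ h11 * h22) ∧ (Literature.Geometry.Lorentzian.Kerr.rPlus 1 a * (1 + 1 / 10) ≤ r → r ≤ 30 → η ≤ h11 ∧ η ≤ h22 ∧ ‖h12‖ ^ 2 ≤ (h11 - η) * (h22 - η))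

/-- item stmt-FinalStateConjecture-9940 · support · rank 9 · open · by planner
sources: arXiv:1402.7034, doi:10.1007/BF00276493
[support] soundness with source (the energy identity ∫z†Hz = Q(L) − Q(−L) − ∫2Re(F(αū' + β̄ū))): a
certificate on [−L, L] with H ⪰ 0, H ⪰ η𝟙 on [c₁, c₂], sup|α|, sup‖β‖ ≤ 1 and the two end
inequalities gives, for every C² u with u'(L) = ik₊u(L), u'(−L) = −ik₋u(−L) and F := u'' + Pu, the
bound η∫_{c₁}^{c₂}(|u'|² + |u|²) ≤ 2∫_{−L}^{L}|F|(|u'| + |u|). Canary for the inlined certificate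
predicate; FTC plus 2×2 Hermitian algebra. [difficulty: provable-now] -/
@[route_item "route-FinalStateConjecture-StorageCertificates"]
def CertificateEstimate : Prop :=
  ∀ (kp km L η c₁ c₂ : ℝ) (P α γ α₁ γ₁ : ℝ → ℝ) (β β₁ : ℝ → ℂ), -L ≤ c₁ → c₁ ≤ c₂ → c₂ ≤ L → ContinuousOn P (Set.Icc (-L) L) → (∀ x, HasDerivAt α (α₁ x) x ∧ HasDerivAt γ (γ₁ x) x ∧ HasDerivAt β (β₁ x) x) → Continuous α₁ → Continuous γ₁ → Continuous β₁ → (∀ x, |α x| ≤ 1 ∧ ‖β x‖ ≤ 1) → γ L + kp ^ 2 * α L + 2 * kp * (β L).im ≤ 0 → 0 ≤ γ (-L) + km ^ 2 * α (-L) - 2 * km * (β (-L)).im → (∀ x ∈ Set.Icc (-L) L, ∀ (h11 h22 : ℝ) (h12 : ℂ), h11 = α₁ x + 2 * (β x).re → h22 = γ₁ x - 2 * P x * (β x).re → h12 = β₁ x + ((γ x - α x * P x : ℝ) : ℂ) → 0 ≤ h11 ∧ 0 ≤ h22 ∧ ‖h12‖ ^ 2 ≤ h11 * h22) → (∀ x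 ∈ Set.Icc c₁ c₂, ∀ (h11 h22 : ℝ) (h12 : ℂ), h11 = α₁ x + 2 * (β x).re → h22 = γ₁ x - 2 * P x * (β x).re → h12 = β₁ x + ((γ x - α x * P x : ℝ) : ℂ) → η ≤ h11 ∧ η ≤ h22 ∧ ‖h12‖ ^ 2 ≤ (h11 - η) * (h22 - η)) → ∀ (u u₁ u₂ : ℝ → ℂ), (∀ x, HasDerivAt u (u₁ x) x ∧ HasDerivAt u₁ (u₂ x) x) → Continuous u₂ → u₁ L = Complex.I * kp * u L → u₁ (-L) = -(Complex.I * km) * u (-L) → η * ∫ x in c₁..c₂, (‖u₁ x‖ ^ 2 + ‖u x‖ ^ 2) ≤ 2 * ∫ x in (-L)..L, ‖u₂ x + (P x : ℂ) * u x‖ * (‖u₁ x‖ + ‖u x‖)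

-- earlier Assembly (stmt-FinalStateConjecture-10927, replaced 2026-08-16T23:16:51Z -> stmt-FinalStateConjecture-17354): retired by None — CertificateFamily → CertificatesToKerrCapture → FinalStateFromKerrCapture → FinalStateConjecture
-- earlier Assembly (stmt-FinalStateConjecture-9942, replaced 2026-08-15T16:32:18Z -> stmt-FinalStateConjecture-10927): retired by None — CertificateFamily → CertificatesToKerrStability → FinalStateFromKerrStability → FinalStateConjecture
/-- item stmt-FinalStateConjecture-17354 · assembly · rank 1 · open · by planner
sources: arXiv:1710.01722, arXiv:1402.7034
[assembly] frame statement #1, X → summit: the certificate theory X = CertificateFamily ∧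
CertificateCompleteness (the thesis) suffices for `FinalStateConjecture`. Not a tautology and not a
hypothesis of `closes`: its proof is exactly the two programme cruxes — `fun hx ↦ h₃ (h₂ hx.1)` with
h₂ : CertificatesToKerrCapture, h₃ : FinalStateFromKerrCapture — so it closes when they do
(CertificateCompleteness enters only as the existence principle behind CertificateFamily). Rev 6
(route-repair 2026-08-16): replaces the rev-2 chain `CertificateFamily → CertificatesToKerrCapture →
FinalStateFromKerrCapture → FinalStateConjecture`, which is literally the type of the deciding
theorem `closes := h₃ (h₂ h₁)`, hence closed by `tauto` and flagged ground.trivial (blocking READY)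
by the grounding battery; the deciding theorem is unchanged. -/
@[route_item "route-FinalStateConjecture-StorageCertificates"]
def Assembly : Prop :=
  CertificateFamily ∧ CertificateCompleteness → FinalStateConjecture

/-! D-0027 §2.1 — DECIDING THEOREM (planner-authored via `route open/edit --closes-file`; by planner-rrepair-FinalStateConjecture-StorageCe-287e7e62-0 2026-08-17T00:03:41Z):
its hypotheses are this route's items and its conclusion the sub-problem Statement (glue_lint), and it elaborates with this file. -/

@[closes "route-FinalStateConjecture-StorageCertificates"] theorem closes : CertificateFamily → CertificatesToKerrCapture → FinalStateFromKerrCapture → FinalStateConjecture :=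
  fun h₁ h₂ h₃ ↦ h₃ (h₂ h₁)

end Summit.FinalStateConjecture.FinalStateConjecture.Theses.StorageCertificates
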